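import Literature.NumberTheory.Automorphic.ResGLnCuspidalCohomologyApexBasic
import Literature.NumberTheory.Automorphic.ResGLnKugaCuspidal
import HarnessLib

/-!
# Clozel's cocycle (apex fact (a′)): the Kuga reduction — every non-zero basic cochain of
# `C^•(𝔤, K_∞; W ⊗ (E_λ ⊗ ε_S))` is a cocycle and not a coboundary

Topic `NumberTheory/Automorphic`; namespace `Literature.NumberTheory.Automorphic.ConeDictionary` (the
vocabulary of `ResGLnConeDictionary` / `ResGLnCuspidalCohomologyApex*` / `ResGLnKuga*`: the complex
`gkComplexLS π S λ = C^•(𝔤, K_∞; W ⊗ (E_λ(ℂ) ⊗ ε_S))` of the SPACE `W` of an automorphic representation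
`π` of `GL_n(𝔸_K)`, its cochains `Cochain π λ q`, level-fixed cochains `IsLevelFixed π λ 𝔫`, the centre
direction `Z = 1 = ⟨1, trivial⟩ ∈ 𝔤`, the relative complex for `K' = 𝔨 ⊕ ℝ·1` (`kPrimeD`) and Kuga's
lemma `d_eq_zero_and_coclosed_of_casimir_scalar`).  Theorems only; no definition, no named fact, no
`sorry` (D-0026: nothing is vendored).

This is the third reduction of the apex fact `ConeDictionary.Clozel1990_exists_basic_levelFixed_cocycle`
(after the level retraction `…ApexLevel` and the basic reduction `…ApexBasic`): by KUGA'S LEMMA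
[cite: BorelWallach2000, II Prop. 3.1 (b)] — for a unitary `(𝔤, K)`-module `V` and a finite-dimensional
`F` on which the Casimir operator acts by the SAME scalar, `H^q(𝔤, K; V ⊗ F) = C^q(𝔤, K; V ⊗ F)`: every
relative cochain is closed and none is exact — the cohomological content of Clozel's Lemme 3.14 for the
clean cuspidal `π` reduces to the EXISTENCE OF A NON-ZERO COCHAIN: a non-zero `K_∞`-homomorphism
`Λ^{q+1}(𝔤/𝔨 ⊕ ℝ·1) → W^{K(𝔫)} ⊗ E_λ ⊗ ε_S`, i.e. a `K_∞`-type condition on `π_∞`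
[cite: Clozel1990, Lemme 3.14 (p. 114) and p. 122] [cite: BorelWallach2000, I §5.1, II §3.1].

* `lieDer_one_eq_zero`, `mem_rel_kPrimeD_of_basic`, `mem_rel_kPrimeD_zero` — when `Z` kills the carrier
  `W ⊗ E_λ` (the scalar `μ + |λ|` of `…ApexBasic.lie_centerOne_carrier` vanishes), `θ_Z = 0` on cochains,
  and a BASIC cochain of `gkComplexLS π S λ` (`i_Z η = 0`; every `0`-cochain) is a cochain of the
  relative complex for `K' = 𝔨 ⊕ ℝ·1` — without assuming it closed (compare
  `ResGLnKugaHarmonicRel.mem_rel_kPrimeD_of_basic_cocycle`);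
* `d_eq_zero_of_basic` — KUGA in positive degree (the tree's `d_eq_zero_and_coclosed_of_casimir_scalar`):
  given a positive Hermitian form on `W` along which the trace-zero Hermitian `x i` are skew, and equal
  Casimir scalars on `W` and `E_λ`, every basic cochain of positive degree is CLOSED;
  `d_eq_zero_of_degree_zero` — KUGA in degree `0` (`ChevalleyEilenbergKugaAdjoint.d_eq_zero_of_rel_zero`
  with `casimirHomotopy_d_zero`): every `0`-cochain (a `K_∞`-invariant vector of `W ⊗ E_λ ⊗ ε_S`) is
  closed, i.e. `𝔤`-invariant [cite: BorelWallach2000, II Prop. 3.1 (b), `q = 0`];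
* `not_mem_coboundaries_of_basic_ne_zero` — hence a NON-ZERO basic cochain `η` of positive degree is not
  a coboundary: were `η = dβ`, the basic part `Bβ = β - α ∧ i_Z β` of `β`
  (`ChevalleyEilenbergCentralSplitting.basicProj`, `α` the normalised trace form of `…ApexBasic`) would be
  a basic primitive (`d ∘ B = B ∘ d` as `θ_Z = 0`, and `Bη = η`), closed by Kuga, so `η = 0`;
  `cocycle_and_not_coboundary_of_basic_ne_zero`, and `…_of_cuspidal` — the same for a clean cuspidal `π`
  with the unitarily normalised Petersson product (`CuspidalPeterssonForm`, as in `ResGLnKugaCuspidal`);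
* **`Clozel1990_exists_basic_levelFixed_cocycle_of_nonzero_basic_cochain`** — the apex fact follows
  from: for every `n ≥ 2`, `𝔫 ≠ 0`, dominant `λ` and clean cohomological cuspidal `π` with a non-zero
  `K(𝔫)`-fixed form, (i) the trace-form Casimir operators act on `W` and on `E_λ` by the same scalar,
  (ii) `Z` kills `W ⊗ E_λ`, and (iii) for some set `S` of real places and some `q` there is a NON-ZERO
  level-`𝔫`-fixed basic cochain `η ∈ C^{q+1}(𝔤, K_∞; W ⊗ (E_λ ⊗ ε_S))`.  (i) and (ii) are consequences
  of the infinity-type hypothesis (the Harish-Chandra parameter `{λ^∨_{τ,i} + ρ_i}` of `π_∞`: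
  `ArchParameterSplitCentre` for `Z`; for the Casimir, `γ(C)(x) = ∑ x_{τ,i}² - |ρ|²`); (iii) is the
  `K_∞`-type content of Lemme 3.14 (Vogan–Zuckerman): `Hom_{K_∞}(Λ^{q+1} 𝔭₀, π_∞ ⊗ E_λ ⊗ ε_S) ≠ 0`.

## References

* L. Clozel, *Motifs et formes automorphes: applications du principe de fonctorialité*, in:
  Automorphic forms, Shimura varieties, and L-functions I (Ann Arbor 1988), Perspect. Math. 10,
  Academic Press 1990: Lemme 3.14 (p. 114, proof pp. 114–120), p. 122. [Clozel1990]
* A. Borel, N. Wallach, *Continuous cohomology, discrete subgroups, and representations of reductive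
  groups*, 2nd ed., AMS 2000: I §1.3, I §5.1, II §2.4–2.5, II Prop. 3.1 (held). [BorelWallach2000]
* D. Vogan, G. Zuckerman, *Unitary representations with non-zero cohomology*, Compositio Math. 53
  (1984), Prop. 5.2 / Thm. 5.6 (the `K`-type criterion). [VoganZuckerman1984]
-/

noncomputable section

open scoped Classical TensorProduct Matrix
open NumberField IsDedekindDomain NumberField.InfinitePlace NumberField.mixedEmbedding

namespace Literature.NumberTheory.Automorphic

-- Mathlib idiom (as in `GKModules` and the whole cone dictionary): commutator bracket on matrix algebras
attribute [local instance 100] LieRing.ofAssociativeRing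

namespace ConeDictionary

open ResGLnCohomology BigHeckeGLn RealMatrixGroup Literature.Algebra.Lie.ChevalleyEilenberg

variable {n : ℕ} {K : Type} [Field K] [NumberField K] {hcpt : isCompact_glFiniteIntegralLevel n K}
  (π : AutomorphicRepData (AutomorphyDatum.gl n K hcpt))
  (S : Finset {w : InfinitePlace K // w.IsReal}) (lam : (K →+* ℂ) → Fin n → ℤ)

/-! ### `Z` killing the carrier: `θ_Z = 0` and basic cochains are `K'`-relative -/

section ZZero

/-- **`θ_Z = 0` on cochains when `Z` kills `W ⊗ E_λ`** (`θ_Z` is post-composition with the action of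
the central `Z`). [cite: BorelWallach2000, I §1.1 and §1.3] -/
theorem lieDer_one_eq_zero
    (hZ : ∀ t : Carrier π lam, ⁅(⟨1, trivial⟩ : (AutomorphyDatum.gl n K hcpt).arch.lie), t⁆ = 0)
    (q : ℕ) (f : Cochain π lam q) :
    lieDer ℝ (AutomorphyDatum.gl n K hcpt).arch.lie (Carrier π lam) q
      (⟨1, trivial⟩ : (AutomorphyDatum.gl n K hcpt).arch.lie) f = 0 := by
  rw [lieDer_eq_smul_of_central (⟨1, trivial⟩ : (AutomorphyDatum.gl n K hcpt).arch.lie)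
    (centerOne_lie n K hcpt) (c := (0 : ℝ)) (fun m => by rw [hZ m, zero_smul]) q f, zero_smul]

/-- **A basic cochain of positive degree of `gkComplexLS π S λ` is `K'`-relative** (`K' = 𝔨 ⊕ ℝ·1`)
once `Z` kills the carrier: `𝔨`-relative by membership, `i_Z η = 0` by hypothesis, `θ_Z η = 0`.
[cite: BorelWallach2000, I §1.3, §5.1] -/
theorem mem_rel_kPrimeD_of_basic
    (hZ : ∀ t : Carrier π lam, ⁅(⟨1, trivial⟩ : (AutomorphyDatum.gl n K hcpt).arch.lie), t⁆ = 0)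
    (q : ℕ) {η : Cochain π lam (q + 1)} (hη : η ∈ (gkComplexLS π S lam).carrier (q + 1))
    (hins : ins q (⟨1, trivial⟩ : (AutomorphyDatum.gl n K hcpt).arch.lie) η = 0) :
    η ∈ (Subcomplex.rel ℝ (𝔤D n K hcpt) (Carrier π lam) (kPrimeD n K hcpt)).carrier (q + 1) := by
  rw [kPrimeD_eq_centralSup, mem_rel_centralSup_succ_iff]
  exact ⟨mem_rel_kInLie_of_mem_gkComplexLS π S lam q hη, hins, lieDer_one_eq_zero π lam hZ (q + 1) η⟩

/-- **Every `0`-cochain of `gkComplexLS π S λ` is `K'`-relative** once `Z` kills the carrier.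
[cite: BorelWallach2000, I §1.3, §5.1] -/
theorem mem_rel_kPrimeD_zero
    (hZ : ∀ t : Carrier π lam, ⁅(⟨1, trivial⟩ : (AutomorphyDatum.gl n K hcpt).arch.lie), t⁆ = 0)
    {β : Cochain π lam 0} (hβ : β ∈ (gkComplexLS π S lam).carrier 0) :
    β ∈ (Subcomplex.rel ℝ (𝔤D n K hcpt) (Carrier π lam) (kPrimeD n K hcpt)).carrier 0 := by
  rw [kPrimeD_eq_centralSup, mem_rel_centralSup_zero_iff]
  rw [gkComplexLS_eq_gK, Subcomplex.mem_gK_iff] at hβ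
  exact ⟨hβ.1, lieDer_one_eq_zero π lam hZ 0 β⟩

end ZZero

/-! ### Kuga: basic cochains are closed, in every degree -/

section Kuga

variable {ip : π.W → π.W → ℂ}

/-- **Kuga, positive degree**: for a positive Hermitian form on `W` along which the trace-zero Hermitian
`x i` act skew-adjointly, equal trace-form Casimir scalars on `W` and `E_λ`, and `Z` killing the carrier,
every BASIC cochain of positive degree of `gkComplexLS π S λ` is closed.
[cite: BorelWallach2000, II Prop. 3.1 (b)] -/
theorem d_eq_zero_of_basic (hip : Kuga.IsPosForm ip)
    (hskew : ∀ (i : Fin (ResGLnCartan.pZeroDim n K)) (v v' : π.W),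
      ip (π.lieDerivW (xD n K hcpt i) v) v' = -ip v (π.lieDerivW (xD n K hcpt i) v'))
    {c c' : ℂ}
    (hc : ∀ v : π.W, GKCasimir.op (AutomorphyDatum.gl n K hcpt).arch π.lieRepW (bD n K hcpt) (dD n K hcpt) v = c • v)
    (hc' : ∀ e : ResGLnCohomology.CoeffModule ℂ n K lam,
      GKCasimir.op (AutomorphyDatum.gl n K hcpt).arch (σ𝔤S hcpt lam) (bD n K hcpt) (dD n K hcpt) e = c' • e)
    (hcc' : c = c')
    (hZ : ∀ t : Carrier π lam, ⁅(⟨1, trivial⟩ : (AutomorphyDatum.gl n K hcpt).arch.lie), t⁆ = 0)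
    (q : ℕ) {η : Cochain π lam (q + 1)} (hη : η ∈ (gkComplexLS π S lam).carrier (q + 1))
    (hins : ins q (⟨1, trivial⟩ : (AutomorphyDatum.gl n K hcpt).arch.lie) η = 0) :
    d ℝ (𝔤D n K hcpt) (Carrier π lam) (q + 1) η = 0 :=
  (d_eq_zero_and_coclosed_of_casimir_scalar π lam hip hskew hc hc' hcc' q
    (mem_rel_kPrimeD_of_basic π S lam hZ q hη hins)).1

/-- **Kuga, degree `0`**: under the same hypotheses every `0`-cochain of `gkComplexLS π S λ` — a
`K_∞`-invariant vector of `W ⊗ E_λ ⊗ ε_S` — is closed, i.e. `𝔤`-invariant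
(`h (dβ) = N β = 0` for the full Casimir homotopy, whose `𝔨`-part dies on the horizontal `dβ`, and the
energy identity `⟪dβ, dβ⟫ = -⟪β, h dβ⟫ = 0`). [cite: BorelWallach2000, II Prop. 3.1 (b)] -/
theorem d_eq_zero_of_degree_zero (hip : Kuga.IsPosForm ip)
    (hskew : ∀ (i : Fin (ResGLnCartan.pZeroDim n K)) (v v' : π.W),
      ip (π.lieDerivW (xD n K hcpt i) v) v' = -ip v (π.lieDerivW (xD n K hcpt i) v'))
    {c c' : ℂ}
    (hc : ∀ v : π.W, GKCasimir.op (AutomorphyDatum.gl n K hcpt).arch π.lieRepW (bD n K hcpt) (dD n K hcpt) v = c • v)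
    (hc' : ∀ e : ResGLnCohomology.CoeffModule ℂ n K lam,
      GKCasimir.op (AutomorphyDatum.gl n K hcpt).arch (σ𝔤S hcpt lam) (bD n K hcpt) (dD n K hcpt) e = c' • e)
    (hcc' : c = c')
    (hZ : ∀ t : Carrier π lam, ⁅(⟨1, trivial⟩ : (AutomorphyDatum.gl n K hcpt).arch.lie), t⁆ = 0)
    {β : Cochain π lam 0} (hβ : β ∈ (gkComplexLS π S lam).carrier 0) :
    d ℝ (𝔤D n K hcpt) (Carrier π lam) 0 β = 0 := by
  have hrel := mem_rel_kPrimeD_zero π S lam hZ hβ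
  have hdh : d ℝ (𝔤D n K hcpt) (Carrier π lam) 0 β ∈
      horizontal (M := Carrier π lam) (kPrimeD n K hcpt) (0 + 1) :=
    (Submodule.mem_inf.1 ((Subcomplex.rel ℝ (𝔤D n K hcpt) (Carrier π lam) (kPrimeD n K hcpt)).d_mem 0 β hrel)).2
  refine d_eq_zero_of_rel_zero (kugaB_self_nonneg π lam hip) (eq_zero_of_kugaB_self π lam hip)
    (kugaD_hspan n K hcpt) (kugaD_hxx n K hcpt)
    (fun i a b => kugaB_lie π lam hip (xD n K hcpt i) (conjTranspose_xD n K hcpt i) (hskew i) a b) hrel ?_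
  have h0 := casimirHomotopy_d_zero (σ := kugaS π lam) (y := Sum.elim (xD n K hcpt) (wD n K hcpt))
    (y' := Sum.elim (xD n K hcpt) (w'D n K hcpt)) β
  rw [casimirHomotopy_sumElim_eq (kPrimeD n K hcpt) (kugaS π lam) (xD n K hcpt) (wD n K hcpt) (w'D n K hcpt)
    (kugaD_hw' n K hcpt) hdh, kuga_hN π lam hc hc' hcc', post_zero] at h0
  exact h0

/-- **A non-zero basic cochain of positive degree is not a coboundary** (Kuga in the degree below, run
on the basic part `Bβ = β - α ∧ i_Z β` of a would-be primitive `β`; in degree one, on `β` itself).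
[cite: BorelWallach2000, II Prop. 3.1 (b), I §1.3] -/
theorem not_mem_coboundaries_of_basic_ne_zero (hip : Kuga.IsPosForm ip)
    (hskew : ∀ (i : Fin (ResGLnCartan.pZeroDim n K)) (v v' : π.W),
      ip (π.lieDerivW (xD n K hcpt i) v) v' = -ip v (π.lieDerivW (xD n K hcpt i) v'))
    {c c' : ℂ}
    (hc : ∀ v : π.W, GKCasimir.op (AutomorphyDatum.gl n K hcpt).arch π.lieRepW (bD n K hcpt) (dD n K hcpt) v = c • v)
    (hc' : ∀ e : ResGLnCohomology.CoeffModule ℂ n K lam,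
      GKCasimir.op (AutomorphyDatum.gl n K hcpt).arch (σ𝔤S hcpt lam) (bD n K hcpt) (dD n K hcpt) e = c' • e)
    (hcc' : c = c')
    (hZ : ∀ t : Carrier π lam, ⁅(⟨1, trivial⟩ : (AutomorphyDatum.gl n K hcpt).arch.lie), t⁆ = 0)
    (hn : 1 ≤ n) (q : ℕ) {η : Cochain π lam (q + 1)}
    (hins : ins q (⟨1, trivial⟩ : (AutomorphyDatum.gl n K hcpt).arch.lie) η = 0) (hne : η ≠ 0) :
    η ∉ (gkComplexLS π S lam).coboundaries (q + 1) := by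
  intro hB
  obtain ⟨β, hβ, hdβ⟩ := ((gkComplexLS π S lam).mem_coboundaries_succ_iff q η).1 hB
  clear hB
  cases q with
  | zero =>
    -- degree one: the primitive `β` is a `0`-cochain, closed by Kuga in degree `0`
    exact hne (hdβ.symm.trans (d_eq_zero_of_degree_zero π S lam hip hskew hc hc' hcc' hZ hβ))
  | succ q =>
    -- the basic part `Bβ` of the primitive `β` is again a primitive of `η`, and it is basic
    have hβ' : basicProj (traceForm n K hcpt) (centerOne n K hcpt) q β ∈ (gkComplexLS π S lam).carrier (q + 1) := by
      rw [gkComplexLS_eq_gK] at hβ ⊢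
      exact basicProj_mem_gK (traceForm n K hcpt) (centerOne n K hcpt) _ (pairActionLS π S lam)
        (fun x hx => traceForm_eq_zero_of_mem_kInLie n K hcpt x hx) (traceForm_lie n K hcpt)
        (traceForm_pairActionLS_σ π S lam) (centerOne_lie n K hcpt) (pairActionLS_σ_centerOne π S lam) q β hβ
    have hθ : ∀ (p : ℕ) (g : Cochain π lam p),
        lieDer ℝ (AutomorphyDatum.gl n K hcpt).arch.lie (Carrier π lam) p (centerOne n K hcpt) g = 0 :=
      lieDer_one_eq_zero π lam hZ
    have hdβ' : d ℝ (𝔤D n K hcpt) (Carrier π lam) (q + 1) (basicProj (traceForm n K hcpt) (centerOne n K hcpt) q β) = η := by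
      rw [d_basicProj (traceForm n K hcpt) (centerOne n K hcpt) (traceForm_lie n K hcpt) hθ q β, hdβ]
      exact basicProj_eq_self (traceForm n K hcpt) (centerOne n K hcpt) hins
    have hins' : ins q (centerOne n K hcpt) (basicProj (traceForm n K hcpt) (centerOne n K hcpt) q β) = 0 :=
      ins_basicProj (traceForm n K hcpt) (centerOne n K hcpt) (traceForm_centerOne n K hcpt hn) q β
    have h0 := d_eq_zero_of_basic π S lam hip hskew hc hc' hcc' hZ q hβ' hins'
    exact hne (hdβ'.symm.trans h0)

/-- **Kuga's reduction for `gkComplexLS π S λ`**: under the hypotheses of `d_eq_zero_of_basic`, a NON-ZERO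
basic cochain of positive degree is a cocycle which is not a coboundary.
[cite: BorelWallach2000, II Prop. 3.1 (b)] -/
theorem cocycle_and_not_coboundary_of_basic_ne_zero (hip : Kuga.IsPosForm ip)
    (hskew : ∀ (i : Fin (ResGLnCartan.pZeroDim n K)) (v v' : π.W),
      ip (π.lieDerivW (xD n K hcpt i) v) v' = -ip v (π.lieDerivW (xD n K hcpt i) v'))
    {c c' : ℂ}
    (hc : ∀ v : π.W, GKCasimir.op (AutomorphyDatum.gl n K hcpt).arch π.lieRepW (bD n K hcpt) (dD n K hcpt) v = c • v)
    (hc' : ∀ e : ResGLnCohomology.CoeffModule ℂ n K lam,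
      GKCasimir.op (AutomorphyDatum.gl n K hcpt).arch (σ𝔤S hcpt lam) (bD n K hcpt) (dD n K hcpt) e = c' • e)
    (hcc' : c = c')
    (hZ : ∀ t : Carrier π lam, ⁅(⟨1, trivial⟩ : (AutomorphyDatum.gl n K hcpt).arch.lie), t⁆ = 0)
    (hn : 1 ≤ n) (q : ℕ) {η : Cochain π lam (q + 1)} (hη : η ∈ (gkComplexLS π S lam).carrier (q + 1))
    (hins : ins q (⟨1, trivial⟩ : (AutomorphyDatum.gl n K hcpt).arch.lie) η = 0) (hne : η ≠ 0) :
    η ∈ (gkComplexLS π S lam).cocycles (q + 1) ∧ η ∉ (gkComplexLS π S lam).coboundaries (q + 1) :=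
  ⟨((gkComplexLS π S lam).mem_cocycles_iff (q + 1) η).2
      ⟨hη, d_eq_zero_of_basic π S lam hip hskew hc hc' hcc' hZ q hη hins⟩,
    not_mem_coboundaries_of_basic_ne_zero π S lam hip hskew hc hc' hcc' hZ hn q hins hne⟩

end Kuga

/-! ### Clean cuspidal `π`: the Petersson product, and the apex fact from a non-zero basic cochain -/

section Cuspidal

/-- **Kuga's reduction for a clean cuspidal `π` of `GL_n(𝔸_K)`, `n ≠ 0`**: if the trace-form Casimir
operators act on `W` and on `E_λ` by the same scalar and `Z` kills `W ⊗ E_λ`, every non-zero basic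
cochain of positive degree of `C^•(𝔤, K_∞; W ⊗ (E_λ ⊗ ε_S))` is a cocycle and not a coboundary (the
positive form is the unitarily normalised Petersson product of `CuspidalPeterssonForm`).
[cite: BorelWallach2000, II Prop. 3.1 (b)] [cite: Clozel1990, Lemme 3.15 (ii) (p. 121) and p. 122] -/
theorem cocycle_and_not_coboundary_of_cuspidal (π : CuspidalAutomorphicRepData n K hcpt) [NeZero n]
    (hW' : π.1.W' = ⊥) {c c' : ℂ}
    (hc : ∀ v : π.1.W, GKCasimir.op (AutomorphyDatum.gl n K hcpt).arch π.1.lieRepW (bD n K hcpt) (dD n K hcpt) v = c • v)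
    (hc' : ∀ e : ResGLnCohomology.CoeffModule ℂ n K lam,
      GKCasimir.op (AutomorphyDatum.gl n K hcpt).arch (σ𝔤S hcpt lam) (bD n K hcpt) (dD n K hcpt) e = c' • e)
    (hcc' : c = c')
    (hZ : ∀ t : Carrier π.1 lam, ⁅(⟨1, trivial⟩ : (AutomorphyDatum.gl n K hcpt).arch.lie), t⁆ = 0)
    (q : ℕ) {η : Cochain π.1 lam (q + 1)} (hη : η ∈ (gkComplexLS π.1 S lam).carrier (q + 1))
    (hins : ins q (⟨1, trivial⟩ : (AutomorphyDatum.gl n K hcpt).arch.lie) η = 0) (hne : η ≠ 0) :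
    η ∈ (gkComplexLS π.1 S lam).cocycles (q + 1) ∧ η ∉ (gkComplexLS π.1 S lam).coboundaries (q + 1) := by
  obtain ⟨μ, hμ⟩ := AdelicGroupData.exists_isAutomorphicMeasure_gl_holds n K
  obtain ⟨T⟩ := π.1.nonempty_unitaryTwist π.2 hW'
  have hn : 1 ≤ n := Nat.one_le_iff_ne_zero.2 (NeZero.ne n)
  exact cocycle_and_not_coboundary_of_basic_ne_zero π.1 S lam (T.isPosForm_pet μ)
    (fun i v v' => T.pet_lieDerivW_left μ (xD n K hcpt i) (ResGLnCartan.mixedTrace_trace_x n K i) v v')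
    hc hc' hcc' hZ hn q hη hins hne

open Literature.NumberTheory.DiophantineGeometry Literature.Barriers.Langlands in
/-- **The apex fact from a non-zero basic cochain (Kuga's reduction).**  It suffices to show, for every
`n ≥ 2`, `𝔫 ≠ 0`, dominant `λ` and clean cohomological cuspidal `π` with a non-zero `K(𝔫)`-fixed form:
(i) the trace-form Casimir operators act on `W` and on `E_λ` by the same scalar, (ii) `Z = 1` kills
`W ⊗ E_λ`, and (iii) for some set `S` of real places and some `q` there is a NON-ZERO level-`𝔫`-fixed
basic cochain `η ∈ C^{q+1}(𝔤, K_∞; W ⊗ (E_λ ⊗ ε_S))`.  Here (i)–(ii) are the infinitesimal character of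
`π_∞` (that of `E_λ^*`) and (iii) is the `K_∞`-type content of Clozel's Lemme 3.14.
[cite: Clozel1990, Lemme 3.14 (p. 114) and p. 122] [cite: BorelWallach2000, II Prop. 3.1 (b)]
[cite: VoganZuckerman1984, Prop. 5.2 and Thm. 5.6] -/
theorem Clozel1990_exists_basic_levelFixed_cocycle_of_nonzero_basic_cochain
    (H : ∀ (n : ℕ) (K : Type) [Field K] [NumberField K] (hcpt : isCompact_glFiniteIntegralLevel n K)
      (𝔫 : Ideal (𝓞 K)) (lam : (K →+* ℂ) → Fin n → ℤ), 2 ≤ n → 𝔫 ≠ 0 →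
      (∀ τ, Weight.IsDominant (lam τ)) →
      ∀ π : CuspidalAutomorphicRepData n K hcpt, π.1.W' = ⊥ →
        (∃ μ : ℂ, ∀ c ∈ π.1.W, lieDeriv (AutomorphyDatum.gl n K hcpt).ofArch
          (⟨1, trivial⟩ : (AutomorphyDatum.gl n K hcpt).arch.lie) c = μ • c) →
        (∃ T : InfinityType K n, π.1.HasInfinityType T ∧
          ∀ τ : K →+* ℂ, (T τ).map ArchWeight.a =
            (cohomologicalInfinityType n K (Weight.dual (lam τ)) τ).map ArchWeight.a) →
        (∃ φ ∈ π.1.W, φ ≠ 0 ∧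
          ∀ u ∈ principalCongruenceLevel n K 𝔫, rightTranslation (AdelicGroupData.gl n K) u φ = φ) →
        (∃ c : ℂ,
          (∀ v : π.1.W, GKCasimir.op (AutomorphyDatum.gl n K hcpt).arch π.1.lieRepW (bD n K hcpt) (dD n K hcpt) v =
            c • v) ∧
          ∀ e : ResGLnCohomology.CoeffModule ℂ n K lam,
            GKCasimir.op (AutomorphyDatum.gl n K hcpt).arch (σ𝔤S hcpt lam) (bD n K hcpt) (dD n K hcpt) e = c • e) ∧
        (∀ t : Carrier π.1 lam, ⁅(⟨1, trivial⟩ : (AutomorphyDatum.gl n K hcpt).arch.lie), t⁆ = 0) ∧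
        ∃ (S : Finset {w : InfinitePlace K // w.IsReal}) (q : ℕ) (η : Cochain π.1 lam (q + 1)),
          η ∈ (gkComplexLS π.1 S lam).carrier (q + 1) ∧ IsLevelFixed π.1 lam 𝔫 η ∧
            Literature.Algebra.Lie.ChevalleyEilenberg.ins q
                (⟨1, trivial⟩ : (AutomorphyDatum.gl n K hcpt).arch.lie) η = 0 ∧ η ≠ 0) :
    Clozel1990_exists_basic_levelFixed_cocycle := by
  intro n K _ _ hcpt 𝔫 lam hn h𝔫 hdom π hW' hμ hT hφ
  have h := H n K hcpt 𝔫 lam hn h𝔫 hdom π hW' hμ hT hφ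
  obtain ⟨⟨c, hc, hc'⟩, hZ, S, q, η, hη, hfix, hins, hne⟩ := h
  haveI : NeZero n := ⟨by omega⟩
  have h' := cocycle_and_not_coboundary_of_cuspidal S lam π hW' hc hc' rfl hZ q hη hins hne
  refine ⟨S, q, η, h'.1, hfix, hins, ?_⟩
  exact h'.2

end Cuspidal

end ConeDictionary

end Literature.NumberTheory.Automorphic

end
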